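import Summits.QuantumFields.YangMills.Theorems.FemtoTransferGapLevels
import HarnessLib

/-!
# Crux RED `RunningReduction`, line «KT» (Kato–Temple–Lehmann door ∕ dressed-Ritz cut): the two objects of the line — definitions

Support DEFINITIONS (no statements of record, no route import) for crux `RunningReduction` (route `LuscherReduction`, item
stmt-QuantumFields-19978), line «KT» registered by the owner ym-beyond-p1 g16 (2026-08-27, `pub/ym-beyond/p1-g16-files/Lines-KT.lean`
sha16 abb17db2d52c586d, card `Lines-KT.md`).  VERBATIM the two `def`s of the skeleton's §1, moved to the Theorems side so that prover files
(which cannot import `Cruxes/…`) can state and prove the line's stubs over TREE constants (same device as `FlatKacFormBound` in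
`LuscherReductionOneSiteLevelsKacDefs`); fleet service by seat ym-infvol-p2:

* `qform2 β ψ φ = ⟨K_β ψ, K_β φ⟩_{L²} = ∫ (K_βψ)(U) (K_βφ)(U) dU` — the two-step form (a thickness-`2a` slab correlator);
* `ritzValue β φ j` — the `j`-th min–max value (from the top) of the pencil `(qform β, l2)` INSIDE the real span of a finite trial family `φ`
  (= the `j`-th Ritz value when `l2` is definite on the span): `inf` over `j` constraint functions IN THE SPAN of the `sup` of the Rayleigh
  quotients of span elements `l2`-orthogonal to them.

HONEST FRAMING: femto-universe rung R2b1 vocabulary at fixed lattice; nothing asserted; not infinite volume, not the Clay gap.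
References: M. Reed, B. Simon IV (1978) Thm XIII.1–2 [cite: ReedSimonIV1978, XIII.1–2]; B. N. Parlett, *The Symmetric Eigenvalue Problem*, chs. 10–11.
-/

set_option autoImplicit false

noncomputable section

open MeasureTheory
open Literature.MathematicalPhysics.QuantumFieldTheory
open Literature.MathematicalPhysics.QuantumLattice

namespace Summit.QuantumFields.YangMills.Theorems.FemtoTransferGap

/-- **Two-step form** `⟨K_β ψ, K_β φ⟩ = ⟨ψ, K_β² φ⟩` (a thickness-`2a` slab correlator): `∫ (∫ K_β(U,V)ψ(V)dV)(∫ K_β(U,W)φ(W)dW) dU`.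
[cite: ReedSimonIV1978, XIII.1–2] -/
def qform2 {L : ℕ} [NeZero L] (β : ℝ) (ψ φ : GaugeConfig 3 L SU2 → ℝ) : ℝ :=
  ∫ U, (∫ V, transferKernel su2Rep β U V * ψ V ∂(configMeasure SU2 L)) *
       (∫ W, transferKernel su2Rep β U W * φ W ∂(configMeasure SU2 L)) ∂(configMeasure SU2 L)

/-- **`j`-th Ritz value** (from the top) of the pencil `(qform β, l2)` INSIDE the real span of a finite trial family `φ`: the infimum over
`j` constraint functions `χ_i` in the span of the supremum of the Rayleigh quotients `⟨ψ,K_βψ⟩/‖ψ‖²` over span elements `ψ` with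
`⟨ψ, χ_i⟩ = 0` and `‖ψ‖² > 0` (= the `j`-th Ritz value when `l2` is definite on the span; junk `sSup ∅ = sInf ∅ = 0`).
[cite: ReedSimonIV1978, XIII.1–2] -/
def ritzValue {L : ℕ} [NeZero L] (β : ℝ) {n : ℕ} (φ : Fin n → (GaugeConfig 3 L SU2 → ℝ)) (j : ℕ) : ℝ :=
  sInf {s | ∃ χ : Fin j → (GaugeConfig 3 L SU2 → ℝ), (∀ i, χ i ∈ Submodule.span ℝ (Set.range φ)) ∧
    s = sSup {r | ∃ ψ ∈ Submodule.span ℝ (Set.range φ), (∀ i, l2 ψ (χ i) = 0) ∧ 0 < l2 ψ ψ ∧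
      r = qform su2Rep β ψ ψ / l2 ψ ψ}}

end Summit.QuantumFields.YangMills.Theorems.FemtoTransferGap

end
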